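import Literature.MathematicalPhysics.QuantumFieldTheory.Balaban1983to89.B9B8KnitLetterTransfer
import Literature.MathematicalPhysics.QuantumFieldTheory.Balaban1983to89.B8Thm2TorusLettersPerConv
import Literature.MathematicalPhysics.QuantumFieldTheory.Balaban1983to89.B9B8KnitLetterProjectionC
import Literature.MathematicalPhysics.QuantumFieldTheory.Balaban1983to89.B9B8KnitLetterRealityLeftInv

/-!
# `Balaban1983to89.B8Thm2TorusLettersPerOfKnit` — M5.9 ASSEMBLY, FILE A2: the v3 letter bundle `B8Thm2TorusLettersPer.LettersAtPer` of [Balaban1985RegularSpaces]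
# Thm 2 on `T_η` CONSTRUCTED from the [Balaban1985BackgroundPropagators] §3 objects at print's transporters (junction J-B: `G′(U)`, `(Q′G′²Q′*)⁻¹`,
# `H′ = G′²Q′*(Q′G′²Q′*)⁻¹` on def-Y's carrier) — the seven letters DEFINED, the periodicity ∕ reads ∕ identity ∕ reality laws PROVED, the six estimate laws
# ((1.92), (1.101), (1.98), (1.59)) DISPLAYED as hypotheses about these very letters

statement-level skeleton of published theorems with citation tags; proofs where landed; nothing here is a claim about the
Yang–Mills mass gap

T. Bałaban, *Spaces of regular gauge field configurations on a lattice and gauge fixing conditions*, Commun. Math. Phys. **99** (1985) 75–102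
[`Balaban1985RegularSpaces`, "[B8]"]: Thm 2 p. 83, p. 77 (*«we admit the case where some domains Ω_j are equal to T_η»*), (1.29) p. 81, (1.91)–(1.92) p. 91
(*«H′ = G′²Q′\*(Q′G′²Q′\*)⁻¹»*, `Q′H′ = I`), (1.95)–(1.98) p. 92 (`G′`, `C`, `R = I − G′Q′ᵀCQ′G′`), (1.101)–(1.103) p. 93, Prop. 5 p. 94, (1.57)–(1.59) p. 86.
T. Bałaban, *Propagators for lattice gauge theories in a background field*, Commun. Math. Phys. **99** (1985) 389–434 [`Balaban1985BackgroundPropagators`, "[4]"]: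
(3.19)–(3.25) pp. 393–395 (`Q′(U)`, `Q′(U)*`, `Δ_U`, `Δ′_a(U)`, *«Its inverse is denoted by G′»*, `R(U)`, *«Δ′_a is positive»*), Thm 3.1 p. 397 ((3.42)), Thm 3.2
p. 398 ((3.48)), Thm 3.3 p. 399, Thm 3.11 p. 416, p. 391 (*«functions with values in N × N hermitian matrices»*).  STATUS: published, refereed.

CITATION HEADER (lean-in-tree rule).  Cell `lit-balaban`, seat `lit-balaban-t2s-1` (gen 4), MODULE M5.9 of the G-B9-LETTERS map of record (`lit-balaban-r06/
B9-LETTERS-MAP.md` §4 «assembly»), file A2; sub-row G-B8-T2S (R3 `stmt-QuantumFields-19200`, helper).  WHY THIS FILE.  The v3 endpoint of sub-row G-B8-T2S,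
`B8Thm2TorusAtOfLettersPerB9.thm2TorusAt_specialUnitary_of_lettersPerB9` (t2s-1 g3), proves [B8] Thm 2 on `T_η` for `SU(N)` from ONE displayed hypothesis: the
letter bundle `LettersAllPer` (for every truncation `n ≤ m`: seven `ℂ`-linear letters `G′, Δ, Q′, Q′ᵀ, 𝔄, C, H′` on `P`-periodic data of `ℤ^{d+1}` and their
laws (P1)–(P6), (E1)–(E16), (U1)–(U3), (B), all at periodic arguments — `B8Thm2TorusLettersPer`).  The junction J-B (seat p33, gens 91–95) has typed the [4]
objects on def-Y's finite carrier at print's composite-contour transporters `parKnitY`: `GpKnitY = η²G′(U)` with (E1) EXACT (`B9B8KnitLetterPeriodic.knit_E1`),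
(U1) (`B9B8KnitLetterRealityLeftInv.knit_U1_at_box`), (E14) (`isSelfAdjoint_GpKnitY_apply`), `C = (Q′G′²Q′*)⁻¹` and `H′ = G′²Q′*C` with (E2), (U2), (E11), (E10),
(E16) EXACT (`B9B8KnitLetterProjectionC`).  This file ASSEMBLES: it DEFINES the consumer's seven letters from def-Y-side letters through the transfer maps of
file A1 (`B9B8KnitLetterTransfer`: `descL ∕ liftL ∕ descBL ∕ liftBL ∕ descXL`, the dictionaries `QprimeIter_liftL_eq_QpY_blkAt`, `QT_liftBL`) and PROVES every
non-estimate law of `LettersAtPer`; the estimate laws — (E6)–(E8) = (1.92) for `H′`, (E12) = (1.101) for `G′`, (E15) = (1.98) for `R`, (B) = (1.59) — and the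
`τ`-laws are carried as displayed hypotheses about THESE letters (p33's files 11∕15∕16∕17–20 and p21∕p38's M5.5–M5.7 bound them on def-Y's side; a norms
dictionary discharges the displayed hypotheses from those, a later file).

THE ARCHITECTURE (generic in the C⋆-algebra `𝔸`, then instantiated at `M_N(ℂ)`).
* §1 `KnitLettersY i n η U₀` — def-Y-SIDE LETTERS AND ALGEBRA at ONE constant-level member `i` (level `n`) and one periodic `ℤ^{d+1}` background `U₀` (read on
  def-Y's torus as `bgY i U₀ = descCfg U₀`): data `G' ∕ C' ∕ H'` (`ℂ`-linear on `SiteY i → 𝔸` ∕ `BlkY i → 𝔸`) and the EXACT identities the junction proves —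
  `e1` ((E1) everywhere, `knit_E1`'s shape), `u1` ((U1) at box points), `e2`, `u2`, `e11`, `e10`, `e14`, `e16` — nothing else; `KnitLettersYTau τ` the three
  `τ`-laws on def-Y's side.  Hypothesis bundles, asserted for nothing.
* §2 THE SEVEN LETTERS OF THE CONSUMER, DEFINED (a family `mem : ℕ → KIdx` of members, one per truncation `n`, all on the torus of side `P`, and
  `dY n : KnitLettersY (mem n) n η U₀`): `knitGp n = liftL ∘ G'ₙ ∘ descL`, `knitLapU = covLapₗ η U₀` ([4] (3.23), the knit's own letter), `knitQp n f = (j ↦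
  1_{torusLam n j}·Q′_j(U₀)f)` (the knit's own `QprimeIter`), `knitQpT n = QTₗ L n (torusLam n) U₀` (the knit's own `QT`), `knitAw = awOp (cKnit η)` (p33's
  junction weights), `knitCinv n = liftBL n ∘ ((L^{d+1})ⁿ • C'ₙ) ∘ descBL` (the factor undoes the two carriers' different normalisations of the adjoint,
  A1's `QT_liftBL`), `knitHp n = liftL ∘ H'ₙ ∘ descXL n`.
* §3 THE LAWS, PROVED: (P1)–(P6) (periodic values), (E3)–(E5) (reads: by `rfl` ∕ indicator), ★ (E1) `gp_right`, ★ (U1) `gp_left_bdd`, ★ (E2) `cinv_range`,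
  ★ (U2) `cinv_range'`, ★ (E11) `qp_hp`, (E10) `hp_real`, (E14) `gp_real`, ★ (E16) `r_real` (through `knitR_eq_liftL`: the consumer's `f − G′Q′ᵀCQ′G′f` IS the lift
  of def-Y's `R`-expression), (E9)∕(E13) (vacuous at `Ω₀ = ℤ^{d+1}`), (U3); the estimate laws and (B) from `KnitEstimates` (displayed, verbatim shapes); ★★★
  `lettersAtPer_ofKnit : LettersAtPer (ℓ+1) BG BR B₀'H B₂' B₀ B₀β cB β len η m α₀ P U₀` and `lettersPerTau_ofKnit`.
* §4 ★★★ AT `𝔸 = M_N(ℂ)`, THE def-Y-SIDE BUNDLE IS INHABITED BY THE JUNCTION'S OBJECTS: `knitLettersY_ofParKnitY i hlev hG hU₀G hU₀per hpar hη :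
  KnitLettersY i n η U₀` with `G' := GpKnitY i η (descCfg U₀)`, `C' := XinvY i parKnitY (η²•GpY i parKnitY) (descCfg U₀)`, `H' := G′G′Q′*(Q′G′²Q′*)⁻¹` — every
  law by NAME from J-B files 3∕4a∕12∕13 (`G ≤ U(N)`, `G`-valued `U₀`, `G`-valued knit legs, `η ≠ 0`); hence ★★★ `lettersAtPer_ofParKnitY`: the consumer's bundle
  at a torus member FROM [4]'s OBJECTS, modulo `KnitEstimates` (the six printed inequalities for these objects) — the displayed hypothesis of the G-B8-T2S
  endpoint made CONCRETE.

HONEST SCOPE.  (i) The def-Y carrier's member constraints are displayed, not relaxed: `L = ℓ + 1 ≥ 5` odd, family index `k ≥ 2`, torus side `N₀ = Lᵏ·L·M_h·P′`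
(`B6KLevelCensusIndexV1.KIdx`), CONSTANT level `n` per truncation (the torus case Ω_j = T_η of [B8] p. 77); the existence of such members for given `(L, m, K, n)`
is NOT asserted here (cf. `B9PinMembersKLevelV1.kIdx_topConst_L5`: at `L = 5` the tree places top cubes).  (ii) `G`-valued knit legs (`hpar`) is a hypothesis
(`B9B8KnitLetterRegular.parKnitY_mem_of_pdev` discharges it on [B7]'s class (52)).  (iii) NO estimate of [B8]∕[4] is proved or asserted: (E6)–(E8), (E12), (E15),
(B) and the `τ`-laws enter as displayed hypotheses (`KnitEstimates`, `KnitLettersYTau`), inhabited by nothing here.  (iv) Count-neutral; N05 ∕ `stub_PV3A` NOT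
discharged; nothing continuum ∕ ℝ⁴ ∕ OS ∕ mass-gap ∕ Clay — the Yang–Mills mass gap is NOT proved.  No `sorry`, no `axiom`, no `… : Prop` fact asserted, no
`instance`, no `notation`.  NEW file; nothing landed is modified.  Seat `lit-balaban-t2s-1` gen 4, 2026-08-28.
-/

noncomputable section

open scoped BigOperators

namespace Literature.MathematicalPhysics.QuantumFieldTheory.Balaban1983to89.B8Thm2TorusLettersPerOfKnit

open B7Prop1Explicit renaming Site → LSite
open B7Prop1Explicit (e)
open B7Prop2Explicit (unitaryUnits)
open B7Eq78Linearization (QprimeIter zdBlocking QprimeIter_add QprimeIter_smul)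
open B8Ineq132 (covDerivFwd InAk)
open B8Eq119TwistedAxial (bgT)
open B8Eq140Level (SideTouches)
open B8Eq138LandauZd (covLap QT IsLandau138W)
open B8Eq1117Concrete (XSpace)
open B8Prop5ContractionKLevel (Bd2)
open B8LambdaSpaceKLevel (wt)
open B8Eq184Proof (cfgExp)
open B8Lemma1NonAbelian (mulCfg)
open B8Eq146AExpansion (iEta plaqCovDeriv)
open B8Eq143PlaqExpansion (pdiv)
open B7Prop4GeneralLevels (linCovIter)
open B8Eq155JBound (Jcur wsup)
open B8ScaledSupNorm (bondNorm msup)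
open B9Eq340HolderZd (hquot AdmPair)
open B8Thm4TorusAt (torusLam mem_torusLam_iff torusLam_self torusLam_of_ne)
open B8Thm2TorusMember (torusLamb)
open B8Thm2TorusLettersPer (LettersAtPer LettersPerTau)
open B8Thm2TorusLettersPerConv (covLapₗ covLapₗ_apply QTₗ QTₗ_apply)
open B12Ineq417Flat (shiftCfg shiftCfg_apply)
open B6GlobalChartV1 (PV boxEquiv)
open B6KLevelCensusIndexV1 (KIdx)
open B9B8CarrierDictionary (liftFun liftCfg descCfg liftCfg_descCfg descCfg_mem)
open B9B8AveragingJunction (parKnitY QpY_parKnitY_eq_QprimeIter)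
open B9B8DeltaPrimeJunction (awOp awOp_apply cKnit QT_torusLam_eq)
open B9B8KnitLetterPeriodic (qLev period_eq_pow_mul constLev_le QprimeIter_periodic QT_periodic knit_E1)
open B9B8KnitLetterTransfer (siteAt siteAt_eq blk_level descL descL_apply liftL liftL_eq liftL_apply descL_liftL liftL_apply_val liftL_descL liftL_add_period
  shiftCfg_liftL period_div_pow blkAt descBL descBL_apply liftBL liftBL_self liftBL_of_ne liftBL_add_period shiftCfg_liftBL_self descBL_liftBL
  liftBL_descBL_self descXL descXL_apply descXL_blkAt descBL_indicator_QprimeIter_liftL QprimeIter_liftL_eq_QpY_blkAt QT_liftBL QT_eq_liftL_QpsY)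
open B9Thm311PositivityKnitLetter (GpKnitY GpKnitY_apply)
open B9B8KnitLetterProjectionC (knit_E2_smul knit_U2_smul knit_E11 knit_E10 RY_parKnitY_smul isSelfAdjoint_RY_parKnitY_apply)
open B9B8KnitLetterRealityLeftInv (isSelfAdjoint_GpKnitY_apply knit_U1_at_box)
open Node00

variable {d ℓ : ℕ} {hd : 1 ≤ d + 1} {hL : Odd (ℓ + 1) ∧ 1 < ℓ + 1} {b₀ b₁ : ℝ}

/-! ## §1 The def-Y-side letters and their exact algebra at one member (hypothesis bundles) -/

section DefYSide

variable {𝔸 : Type} [NormedRing 𝔸] [NormedAlgebra ℂ 𝔸] [CompleteSpace 𝔸] [StarRing 𝔸]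

/-- **THE MEMBER's BACKGROUND**: the `P`-periodic `ℤ^{d+1}` configuration `U₀` of the consumer read on def-Y's torus (J-A's `descCfg`).
[cite: Balaban1985RegularSpaces, p.77 («Ω_j = T_η»); Balaban1985BackgroundPropagators, p.390 («U defined on bonds of T_η»), dictionary] -/
def bgY (i : KIdx d ℓ hd hL b₀ b₁) (U₀ : LSite (d + 1) → Fin (d + 1) → 𝔸ˣ) : CfgY 𝔸 i := descCfg U₀

omit [StarRing 𝔸] in
/-- the member's background lifts back to `U₀` when `U₀` is `N₀`-periodic. [cite: Balaban1985RegularSpaces, (1.3) p.77, p.77 («Ω_j = T_η»), dictionary] -/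
theorem liftCfg_bgY (i : KIdx d ℓ hd hL b₀ b₁) {U₀ : LSite (d + 1) → Fin (d + 1) → 𝔸ˣ}
    (hU₀ : ∀ μ : Fin (d + 1), shiftCfg ((((PV d ℓ i.m i.K hd hL).sitesPerDir 0 : ℕ) : ℤ) • e μ) U₀ = U₀) : liftCfg (bgY i U₀) = U₀ :=
  liftCfg_descCfg (P := PV d ℓ i.m i.K hd hL) hU₀

omit [StarRing 𝔸] in
/-- the member's background is `G`-valued when `U₀` is. [cite: Balaban1985BackgroundPropagators, p.390 («with values in G»), dictionary] -/
theorem bgY_mem (i : KIdx d ℓ hd hL b₀ b₁) {G : Subgroup 𝔸ˣ} {U₀ : LSite (d + 1) → Fin (d + 1) → 𝔸ˣ} (hU₀ : ∀ x μ, U₀ x μ ∈ G) :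
    ∀ μ x, bgY i U₀ μ x ∈ G :=
  descCfg_mem (P := PV d ℓ i.m i.K hd hL) hU₀

/-- **THE def-Y-SIDE LETTERS OF [4] §3 AT ONE MEMBER AND THEIR EXACT ALGEBRA** (the part of `B8Thm2TorusLetters.LettersAt` that the junction J-B proves EXACTLY at
print's transporters): at a member `i` of constant level `n`, `η`, and a periodic `ℤ^{d+1}` background `U₀` (read on def-Y's torus as `bgY i U₀`): the letters
`G'` (print's `G′(U) = Δ′_a(U)⁻¹` in the knit's `η`-units), `C'` (`(Q′G′²Q′*)⁻¹` for `G'`), `H'` (`G′²Q′*(Q′G′²Q′*)⁻¹`, (1.91)) as `ℂ`-linear maps on def-Y's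
carriers, with: `e1` — (E1) `Δ_{U₀}(G'X)♯ + Q′ᵀ𝔄Q′(G'X)♯ = X♯` on `ℤ^{d+1}` (`♯` = periodic extension `liftL`); `u1` — (U1) `G'(Δ_{U₀}Λ♯ + Q′ᵀ𝔄Q′Λ♯)|box = Λ`;
`e2`∕`u2` — (3.25)'s `Q′G′G′Q′*CQ′ = Q′`, `Q′*CQ′G′G′Q′* = Q′*`; `e11` — `Q′H′ = 1`; `e10` — `H′(−X⋆) = −(H′X)⋆`; `e14` — `G′` preserves hermitian-valued
functions; `e16` — `R = 1 − G′Q′*CQ′G′` does.  A hypothesis bundle (asserted for nothing; §4 inhabits it at `M_N(ℂ)` from J-B).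
[cite: Balaban1985BackgroundPropagators, (3.19)–(3.25) pp.393–395, Thm 3.11 p.416, p.391; Balaban1985RegularSpaces, (1.91) p.91, (1.95)–(1.98) p.92, Prop. 5 p.94] -/
structure KnitLettersY (i : KIdx d ℓ hd hL b₀ b₁) (n : ℕ) (η : ℝ) (U₀ : LSite (d + 1) → Fin (d + 1) → 𝔸ˣ) where
  /-- `G′(U₀)` on def-Y's site carrier (knit units: `η²·Δ′_a(U)⁻¹`). -/
  G' : (SiteY i → 𝔸) →ₗ[ℂ] (SiteY i → 𝔸)
  /-- `C = (Q′G′²Q′*)⁻¹` for `G'` on def-Y's block carrier. -/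
  C' : (BlkY i → 𝔸) →ₗ[ℂ] (BlkY i → 𝔸)
  /-- `H′ = G′²Q′*(Q′G′²Q′*)⁻¹`, blocks → sites. -/
  H' : (BlkY i → 𝔸) →ₗ[ℂ] (SiteY i → 𝔸)
  /-- (E1) on `ℤ^{d+1}`, for the periodic extension of every box function `X`. -/
  e1 : ∀ (X : SiteY i → 𝔸) (x : LSite (d + 1)),
    covLap η U₀ (liftL i (G' X)) x
        + QT (ℓ + 1) n (torusLam n) U₀
            (awOp (cKnit (d := d) (ℓ := ℓ) η) fun j => QprimeIter (zdBlocking (d + 1) (ℓ + 1)) (bgT (ℓ + 1) U₀) j (liftL i (G' X))) x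
      = liftL i X x
  /-- (U1) at the box points. -/
  u1 : ∀ Λ : SiteY i → 𝔸,
    G' (fun z : SiteY i => covLap η U₀ (liftL i Λ) z.1
        + QT (ℓ + 1) n (torusLam n) U₀
            (awOp (cKnit (d := d) (ℓ := ℓ) η) fun j => QprimeIter (zdBlocking (d + 1) (ℓ + 1)) (bgT (ℓ + 1) U₀) j (liftL i Λ)) z.1) = Λ
  /-- (E2) `Q′G′G′Q′*CQ′Φ = Q′Φ`. -/
  e2 : ∀ Φ : SiteY i → 𝔸,
    QpY i (parKnitY i) (bgY i U₀) (G' (G' (QpsY i (parKnitY i) (bgY i U₀) (C' (QpY i (parKnitY i) (bgY i U₀) Φ))))) = QpY i (parKnitY i) (bgY i U₀) Φ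
  /-- (U2) `Q′*CQ′G′G′Q′*φ = Q′*φ`. -/
  u2 : ∀ φ : BlkY i → 𝔸,
    QpsY i (parKnitY i) (bgY i U₀) (C' (QpY i (parKnitY i) (bgY i U₀) (G' (G' (QpsY i (parKnitY i) (bgY i U₀) φ))))) = QpsY i (parKnitY i) (bgY i U₀) φ
  /-- (E11) `Q′H′ = 1`. -/
  e11 : ∀ Y : BlkY i → 𝔸, QpY i (parKnitY i) (bgY i U₀) (H' Y) = Y
  /-- (E10) `H′(−X⋆) = −(H′X)⋆` pointwise. -/
  e10 : ∀ Xf Yf : BlkY i → 𝔸, (∀ p, Yf p = -star (Xf p)) → ∀ z, H' Yf z = -star (H' Xf z)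
  /-- (E14) `G′` maps hermitian-valued to hermitian-valued. -/
  e14 : ∀ Λ : SiteY i → 𝔸, (∀ w, IsSelfAdjoint (Λ w)) → ∀ z, IsSelfAdjoint (G' Λ z)
  /-- (E16) `R = 1 − G′Q′*CQ′G′` maps hermitian-valued to hermitian-valued. -/
  e16 : ∀ Φ : SiteY i → 𝔸, (∀ w, IsSelfAdjoint (Φ w)) →
    ∀ z, IsSelfAdjoint ((Φ - G' (QpsY i (parKnitY i) (bgY i U₀) (C' (QpY i (parKnitY i) (bgY i U₀) (G' Φ))))) z)

/-- **THE `τ`-LAWS ON def-Y's SIDE** (print p. 76: for `G = SU(N)` the configurations are `𝔰𝔲(N)`-valued; `τ = tr`): `H'`, `G'` and `R` map `τ`-free data to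
`τ`-free values.  A hypothesis bundle. [cite: Balaban1985RegularSpaces, p.76, (1.91)–(1.98) pp.91–92] -/
structure KnitLettersYTau (τ : 𝔸 →L[ℂ] ℂ) {i : KIdx d ℓ hd hL b₀ b₁} {n : ℕ} {η : ℝ} {U₀ : LSite (d + 1) → Fin (d + 1) → 𝔸ˣ}
    (K : KnitLettersY i n η U₀) : Prop where
  /-- `H′` preserves `τ`-freeness. -/
  h_tau : ∀ Y : BlkY i → 𝔸, (∀ p, τ (Y p) = 0) → ∀ z, τ (K.H' Y z) = 0
  /-- `G′` preserves `τ`-freeness. -/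
  g_tau : ∀ Λ : SiteY i → 𝔸, (∀ w, τ (Λ w) = 0) → ∀ z, τ (K.G' Λ z) = 0
  /-- `R` preserves `τ`-freeness. -/
  r_tau : ∀ Φ : SiteY i → 𝔸, (∀ w, τ (Φ w) = 0) →
    ∀ z, τ ((Φ - K.G' (QpsY i (parKnitY i) (bgY i U₀) (K.C' (QpY i (parKnitY i) (bgY i U₀) (K.G' Φ))))) z) = 0

end DefYSide

/-! ## §2 The consumer's seven letters, DEFINED from the def-Y-side letters through the transfer maps -/

section Letters

variable {𝔸 : Type} [CStarAlgebra 𝔸]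
variable (mem : ℕ → KIdx d ℓ hd hL b₀ b₁) (η : ℝ) (U₀ : LSite (d + 1) → Fin (d + 1) → 𝔸ˣ) {m : ℕ}
variable (dY : ∀ n, 1 ≤ n → n ≤ m → KnitLettersY (mem n) n η U₀)

/-- **`G′` AT TRUNCATION `n`** on the consumer's carrier: restrict to the box, apply def-Y's `G'ₙ`, extend periodically (zero outside `1 ≤ n ≤ m`, where the
consumer reads nothing). [cite: Balaban1985RegularSpaces, (1.95) p.92; Balaban1985BackgroundPropagators, p.394 («Its inverse is denoted by G′»), Thm 3.1 p.397] -/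
def knitGp (n : ℕ) : (LSite (d + 1) → 𝔸) →ₗ[ℂ] (LSite (d + 1) → 𝔸) :=
  if h : 1 ≤ n ∧ n ≤ m then liftL (mem n) ∘ₗ (dY n h.1 h.2).G' ∘ₗ descL (mem n) else 0

/-- **`Δ` (the covariant Laplacian at `U₀`)** — the knit's own letter `covLap η U₀`, `ℂ`-linear. [cite: Balaban1985BackgroundPropagators, (3.23) p.394; Balaban1985RegularSpaces, (1.2) p.76] -/
def knitLapU : (LSite (d + 1) → 𝔸) →ₗ[ℂ] (LSite (d + 1) → 𝔸) := covLapₗ η U₀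

/-- **`Q′` AT TRUNCATION `n`**: the knit's own iterated average `Q′_n(U₀)` at the member's level, zero at the other levels (the constraint sets of the torus member
are `torusLam n j`: the whole `n`-lattice at `j = n`, nothing below). [cite: Balaban1985BackgroundPropagators, (3.19) p.393; Balaban1985RegularSpaces, (1.28)–(1.29) p.81, (1.5)–(1.6) p.77] -/
def knitQp (n : ℕ) : (LSite (d + 1) → 𝔸) →ₗ[ℂ] (ℕ → LSite (d + 1) → 𝔸) where
  toFun f := fun j y => if j = n then QprimeIter (zdBlocking (d + 1) (ℓ + 1)) (bgT (ℓ + 1) U₀) j f y else 0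
  map_add' f g := by
    funext j y
    by_cases hj : j = n
    · simp only [hj, if_true, Pi.add_apply]
      exact congrFun (QprimeIter_add (G := zdBlocking (d + 1) (ℓ + 1)) (T := bgT (ℓ + 1) U₀) f g n) y
    · simp only [hj, if_false, Pi.add_apply, add_zero]
  map_smul' c f := by
    funext j y
    by_cases hj : j = n
    · simp only [hj, if_true, Pi.smul_apply, RingHom.id_apply]
      exact congrFun (QprimeIter_smul (G := zdBlocking (d + 1) (ℓ + 1)) (T := bgT (ℓ + 1) U₀) c f n) y
    · simp only [hj, if_false, Pi.smul_apply, RingHom.id_apply, smul_zero]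

/-- the knit `Q′`, evaluated. [cite: Balaban1985BackgroundPropagators, (3.19) p.393, bookkeeping] -/
theorem knitQp_apply (n : ℕ) (f : LSite (d + 1) → 𝔸) (j : ℕ) (y : LSite (d + 1)) :
    knitQp (ℓ := ℓ) U₀ n f j y = if j = n then QprimeIter (zdBlocking (d + 1) (ℓ + 1)) (bgT (ℓ + 1) U₀) j f y else 0 := rfl

/-- the knit `Q′` at the member's level is the `n`-fold average. [cite: Balaban1985BackgroundPropagators, (3.19) p.393; Balaban1985RegularSpaces, (1.5) p.77] -/
theorem knitQp_self (n : ℕ) (f : LSite (d + 1) → 𝔸) : knitQp (ℓ := ℓ) U₀ n f n = QprimeIter (zdBlocking (d + 1) (ℓ + 1)) (bgT (ℓ + 1) U₀) n f :=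
  funext fun y => by rw [knitQp_apply, if_pos rfl]

/-- the same at a level index equal to `n`. [cite: Balaban1985BackgroundPropagators, (3.19) p.393, bookkeeping] -/
theorem knitQp_of_eq (n : ℕ) (f : LSite (d + 1) → 𝔸) {j : ℕ} (hj : j = n) :
    knitQp (ℓ := ℓ) U₀ n f j = QprimeIter (zdBlocking (d + 1) (ℓ + 1)) (bgT (ℓ + 1) U₀) n f := by
  subst hj; exact knitQp_self U₀ _ f

/-- the knit `Q′` vanishes off the member's level. [cite: Balaban1985RegularSpaces, (1.5)–(1.6) p.77, bookkeeping] -/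
theorem knitQp_of_ne (n : ℕ) (f : LSite (d + 1) → 𝔸) {j : ℕ} (hj : j ≠ n) : knitQp (ℓ := ℓ) U₀ n f j = 0 :=
  funext fun y => by rw [knitQp_apply, if_neg hj, Pi.zero_apply]

/-- **`Q′ᵀ` AT TRUNCATION `n`** — the knit's own letter `QT L n (torusLam n) U₀`, `ℂ`-linear. [cite: Balaban1985RegularSpaces, (1.29) p.81; Balaban1985BackgroundPropagators, (3.24) p.394] -/
def knitQpT (n : ℕ) : (ℕ → LSite (d + 1) → 𝔸) →ₗ[ℂ] (LSite (d + 1) → 𝔸) := QTₗ (ℓ + 1) n (torusLam (d := d + 1) n) U₀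

/-- **`𝔄`** — p33's junction weights `c_j = η⁻²·levC_j·W_j²` (print's `a_j(Lʲη)^{d−2}` up to units). [cite: Balaban1985BackgroundPropagators, (3.24) p.394] -/
def knitAw : (ℕ → LSite (d + 1) → 𝔸) →ₗ[ℂ] (ℕ → LSite (d + 1) → 𝔸) := awOp (cKnit (d := d) (ℓ := ℓ) η)

/-- **`C` AT TRUNCATION `n`**: read a level family on the blocks, apply `(L^{d+1})ⁿ · C'ₙ`, extend to a level family (the factor `(L^{d+1})ⁿ` converts def-Y's
adjoint `Q′*` to the knit's transpose `Q′ᵀ`, file A1's `QT_liftBL`); zero outside `1 ≤ n ≤ m`. [cite: Balaban1985RegularSpaces, (1.96)–(1.97) p.92; Balaban1985BackgroundPropagators, (3.25) p.395, Thm 3.2 p.398] -/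
def knitCinv (n : ℕ) : (ℕ → LSite (d + 1) → 𝔸) →ₗ[ℂ] (ℕ → LSite (d + 1) → 𝔸) :=
  if h : 1 ≤ n ∧ n ≤ m then
    liftBL (mem n) n ∘ₗ (((((((ℓ + 1 : ℕ) : ℝ)) ^ (d + 1)) ^ n : ℝ) : ℂ) • (dY n h.1 h.2).C') ∘ₗ descBL (mem n)
  else 0

/-- **`H′` AT TRUNCATION `n`**: read an `XSpace` family on the blocks (top level), apply `H'ₙ`, extend periodically; zero outside `1 ≤ n ≤ m`.
[cite: Balaban1985RegularSpaces, (1.91)–(1.92) p.91] -/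
def knitHp (n : ℕ) : XSpace (d := d + 1) n 𝔸 →ₗ[ℂ] (LSite (d + 1) → 𝔸) :=
  if h : 1 ≤ n ∧ n ≤ m then liftL (mem n) ∘ₗ (dY n h.1 h.2).H' ∘ₗ descXL (mem n) n else 0

/-! ### unfolding lemmas (inside the range `1 ≤ n ≤ m`) -/

variable {n : ℕ}

/-- `knitGp`, unfolded. [cite: Balaban1985RegularSpaces, (1.95) p.92, bookkeeping] -/
theorem knitGp_apply (hn : 1 ≤ n) (hnm : n ≤ m) (f : LSite (d + 1) → 𝔸) :
    knitGp mem η U₀ dY n f = liftL (mem n) ((dY n hn hnm).G' (descL (mem n) f)) := by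
  rw [knitGp, dif_pos ⟨hn, hnm⟩]; rfl

/-- `knitGp` of a periodic extension. [cite: Balaban1985RegularSpaces, (1.95) p.92, bookkeeping] -/
theorem knitGp_liftL (hn : 1 ≤ n) (hnm : n ≤ m) (Ψ : SiteY (mem n) → 𝔸) :
    knitGp mem η U₀ dY n (liftL (mem n) Ψ) = liftL (mem n) ((dY n hn hnm).G' Ψ) := by
  rw [knitGp_apply mem η U₀ dY hn hnm, descL_liftL]

/-- `knitQpT`, evaluated. [cite: Balaban1985RegularSpaces, (1.29) p.81, bookkeeping] -/
theorem knitQpT_apply (n : ℕ) (μ : ℕ → LSite (d + 1) → 𝔸) (x : LSite (d + 1)) :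
    knitQpT (ℓ := ℓ) U₀ n μ x = QT (ℓ + 1) n (torusLam (d := d + 1) n) U₀ μ x := rfl

/-- `knitCinv`, unfolded. [cite: Balaban1985RegularSpaces, (1.96) p.92, bookkeeping] -/
theorem knitCinv_apply (hn : 1 ≤ n) (hnm : n ≤ m) (μ : ℕ → LSite (d + 1) → 𝔸) :
    knitCinv mem η U₀ dY n μ
      = liftBL (mem n) n ((((((((ℓ + 1 : ℕ) : ℝ)) ^ (d + 1)) ^ n : ℝ) : ℂ)) • (dY n hn hnm).C' (descBL (mem n) μ)) := by
  rw [knitCinv, dif_pos ⟨hn, hnm⟩]; rfl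

/-- `knitHp`, unfolded. [cite: Balaban1985RegularSpaces, (1.91) p.91, bookkeeping] -/
theorem knitHp_eq (hn : 1 ≤ n) (hnm : n ≤ m) (X : XSpace (d := d + 1) n 𝔸) :
    knitHp mem η U₀ dY n X = liftL (mem n) ((dY n hn hnm).H' (descXL (mem n) n X)) := by
  rw [knitHp, dif_pos ⟨hn, hnm⟩]; rfl

/-- `knitHp`, evaluated. [cite: Balaban1985RegularSpaces, (1.91) p.91, bookkeeping] -/
theorem knitHp_apply (hn : 1 ≤ n) (hnm : n ≤ m) (X : XSpace (d := d + 1) n 𝔸) (x : LSite (d + 1)) :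
    knitHp mem η U₀ dY n X x = (dY n hn hnm).H' (descXL (mem n) n X) (siteAt (mem n) x) := by
  rw [knitHp_eq mem η U₀ dY hn hnm, liftL_apply]

/-- the `Q′ᵀ𝔄`-term reads only the member's level: `QT … (𝔄 (knitQp g)) = QT … (𝔄 (j ↦ Q′_j g))`. [cite: Balaban1985RegularSpaces, (1.5)–(1.6) p.77, (1.29) p.81; Balaban1985BackgroundPropagators, (3.24) p.394] -/
theorem QT_knitAw_knitQp (n : ℕ) (g : LSite (d + 1) → 𝔸) (x : LSite (d + 1)) :
    QT (ℓ + 1) n (torusLam (d := d + 1) n) U₀ (knitAw (d := d) (ℓ := ℓ) η (knitQp (ℓ := ℓ) U₀ n g)) x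
      = QT (ℓ + 1) n (torusLam (d := d + 1) n) U₀
          (awOp (cKnit (d := d) (ℓ := ℓ) η) fun j => QprimeIter (zdBlocking (d + 1) (ℓ + 1)) (bgT (ℓ + 1) U₀) j g) x := by
  rw [QT_torusLam_eq, QT_torusLam_eq]
  congr 1
  funext y
  rw [knitAw, awOp_apply, awOp_apply, knitQp_self]

end Letters

/-! ## §3 The laws, proved; the estimate laws displayed; the bundle `LettersAtPer` assembled -/

section Laws

variable {𝔸 : Type} [CStarAlgebra 𝔸]
variable (mem : ℕ → KIdx d ℓ hd hL b₀ b₁) (η : ℝ) (U₀ : LSite (d + 1) → Fin (d + 1) → 𝔸ˣ) {m : ℕ}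
variable (dY : ∀ n, 1 ≤ n → n ≤ m → KnitLettersY (mem n) n η U₀)
variable {P : ℤ}
variable (hP : ∀ n, 1 ≤ n → n ≤ m → (((PV d ℓ (mem n).m (mem n).K hd hL).sitesPerDir 0 : ℕ) : ℤ) = P)
variable (hlev : ∀ n, 1 ≤ n → n ≤ m → ∀ z : SiteY (mem n), levY (mem n) z = n)
variable (hU₀per : ∀ (x : LSite (d + 1)) (μ : Fin (d + 1)), U₀ (x + P • e μ) = U₀ x)

include hP hU₀per in
/-- the period of member `n`'s torus is `P`: `shiftCfg` form of the periodicity of `U₀`. [cite: Balaban1985RegularSpaces, (1.3) p.77, bookkeeping] -/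
theorem shiftCfg_U₀ {n : ℕ} (hn : 1 ≤ n) (hnm : n ≤ m) :
    ∀ μ : Fin (d + 1), shiftCfg ((((PV d ℓ (mem n).m (mem n).K hd hL).sitesPerDir 0 : ℕ) : ℤ) • e μ) U₀ = U₀ := fun μ => by
  funext x; rw [shiftCfg_apply, hP n hn hnm, hU₀per]

include hP hU₀per in
/-- member `n`'s def-Y background lifts back to `U₀`. [cite: Balaban1985RegularSpaces, p.77 («Ω_j = T_η»), bookkeeping] -/
theorem liftCfg_bgY_mem {n : ℕ} (hn : 1 ≤ n) (hnm : n ≤ m) : liftCfg (bgY (mem n) U₀) = U₀ :=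
  liftCfg_bgY (mem n) (shiftCfg_U₀ mem U₀ hP hU₀per hn hnm)

include hP in
/-- a `P`-periodic function is `N₀`-periodic for member `n`'s torus. [cite: Balaban1985RegularSpaces, (1.3) p.77, bookkeeping] -/
theorem per_mem {n : ℕ} (hn : 1 ≤ n) (hnm : n ≤ m) {β : Type*} {f : LSite (d + 1) → β}
    (hf : ∀ (z : LSite (d + 1)) (i : Fin (d + 1)), f (z + P • e i) = f z) :
    ∀ (x : LSite (d + 1)) (μ : Fin (d + 1)), f (x + ((((PV d ℓ (mem n).m (mem n).K hd hL).sitesPerDir 0 : ℕ) : ℤ)) • e μ) = f x :=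
  fun x μ => by rw [hP n hn hnm]; exact hf x μ

omit [CStarAlgebra 𝔸] in
include hP in
/-- a level-periodic family (period `P∕Lʲ` at level `j ≤ n`) is `N₀∕Lʲ`-periodic for member `n`'s torus. [cite: Balaban1985RegularSpaces, (1.3)–(1.6) p.77, bookkeeping] -/
theorem levPer_mem {n : ℕ} (hn : 1 ≤ n) (hnm : n ≤ m) {μ : ℕ → LSite (d + 1) → 𝔸}
    (hμ : ∀ j, j ≤ n → ∀ (y : LSite (d + 1)) (i : Fin (d + 1)), μ j (y + (P / (((ℓ + 1 : ℕ) : ℤ)) ^ j) • e i) = μ j y) :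
    ∀ j, j ≤ n → ∀ (y : LSite (d + 1)) (ν : Fin (d + 1)),
      μ j (y + (((((PV d ℓ (mem n).m (mem n).K hd hL).sitesPerDir 0 : ℕ) : ℤ)) / (((ℓ + 1 : ℕ) : ℤ)) ^ j) • e ν) = μ j y :=
  fun j hj y ν => by rw [hP n hn hnm]; exact hμ j hj y ν

include hP in
/-- a level-periodic `XSpace` family is `N₀∕Lʲ`-periodic for member `n`'s torus. [cite: Balaban1985RegularSpaces, (1.3)–(1.6) p.77, (1.91) p.91, bookkeeping] -/
theorem levPerX_mem {n : ℕ} (hn : 1 ≤ n) (hnm : n ≤ m) {X : XSpace (d := d + 1) n 𝔸}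
    (hX : ∀ (p : Fin (n + 1) × LSite (d + 1)) (i : Fin (d + 1)), X (p.1, p.2 + (P / (((ℓ + 1 : ℕ) : ℤ)) ^ (p.1 : ℕ)) • e i) = X p) :
    ∀ (p : Fin (n + 1) × LSite (d + 1)) (ν : Fin (d + 1)),
      X (p.1, p.2 + (((((PV d ℓ (mem n).m (mem n).K hd hL).sitesPerDir 0 : ℕ) : ℤ)) / (((ℓ + 1 : ℕ) : ℤ)) ^ (p.1 : ℕ)) • e ν) = X p :=
  fun p ν => by rw [hP n hn hnm]; exact hX p ν

/-! ### the dictionaries of file A1 at member `n`, read at the background `U₀` -/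

include hP hlev hU₀per in
/-- `Q′_n(U₀)` of a periodic extension, at every point of the `n`-lattice, is def-Y's `Q′` at `blkAt n y`. [cite: Balaban1985BackgroundPropagators, (3.19) p.393, (3.21) p.394; Balaban1985RegularSpaces, (1.29) p.81] -/
theorem QprimeIter_liftL_mem {n : ℕ} (hn : 1 ≤ n) (hnm : n ≤ m) (Φ : SiteY (mem n) → 𝔸) (y : LSite (d + 1)) :
    QprimeIter (zdBlocking (d + 1) (ℓ + 1)) (bgT (ℓ + 1) U₀) n (liftL (mem n) Φ) y = QpY (mem n) (parKnitY (mem n)) (bgY (mem n) U₀) Φ (blkAt (mem n) n y) := by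
  have h := QprimeIter_liftL_eq_QpY_blkAt (mem n) (hlev n hn hnm) (bgY (mem n) U₀) Φ y
  rwa [liftCfg_bgY_mem mem U₀ hP hU₀per hn hnm] at h

include hP hlev hU₀per in
/-- the block reading of `knitQp n` of a periodic extension is def-Y's `Q′`. [cite: Balaban1985BackgroundPropagators, (3.19) p.393, (3.21) p.394; Balaban1985RegularSpaces, (1.29) p.81] -/
theorem descBL_knitQp_liftL {n : ℕ} (hn : 1 ≤ n) (hnm : n ≤ m) (Φ : SiteY (mem n) → 𝔸) :
    descBL (mem n) (knitQp (ℓ := ℓ) U₀ n (liftL (mem n) Φ)) = QpY (mem n) (parKnitY (mem n)) (bgY (mem n) U₀) Φ := by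
  funext s
  have hs : s.1.1 = n := B9B8KnitLetterTransfer.blk_level (mem n) (hlev n hn hnm) s
  have h := QpY_parKnitY_eq_QprimeIter (mem n) (bgY (mem n) U₀) Φ s
  rw [liftCfg_bgY_mem mem U₀ hP hU₀per hn hnm, ← liftL_eq, hs] at h
  rw [descBL_apply, knitQp_apply, if_pos hs, hs]
  exact h.symm

include hP hlev hU₀per in
/-- `knitQpT n` of an extended block function is `(L^{−(d+1)})ⁿ ·` the periodic extension of def-Y's `Q′*` (A1's transpose dictionary at `U₀`).
[cite: Balaban1985RegularSpaces, (1.29) p.81; Balaban1985BackgroundPropagators, (3.24)–(3.25) pp.394–395] -/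
theorem knitQpT_liftBL {n : ℕ} (hn : 1 ≤ n) (hnm : n ≤ m) (ψ : BlkY (mem n) → 𝔸) :
    knitQpT (ℓ := ℓ) U₀ n (liftBL (mem n) n ψ)
      = ((((((ℓ + 1 : ℕ) : ℝ)) ^ (d + 1))⁻¹) ^ n : ℝ) • liftL (mem n) (QpsY (mem n) (parKnitY (mem n)) (bgY (mem n) U₀) ψ) := by
  funext x
  have h := QT_liftBL (mem n) (hlev n hn hnm) (bgY (mem n) U₀) ψ x
  rw [liftCfg_bgY_mem mem U₀ hP hU₀per hn hnm] at h
  rw [knitQpT_apply, h, Pi.smul_apply]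

include hP hlev hU₀per in
/-- ★ `Q′ᵀ ∘ C` of the consumer IS the periodic extension of def-Y's `Q′* ∘ C'` (the normalisation factors cancel).
[cite: Balaban1985RegularSpaces, (1.96)–(1.97) p.92, (1.29) p.81; Balaban1985BackgroundPropagators, (3.25) p.395] -/
theorem knitQpT_knitCinv {n : ℕ} (hn : 1 ≤ n) (hnm : n ≤ m) (μ : ℕ → LSite (d + 1) → 𝔸) :
    knitQpT (ℓ := ℓ) U₀ n (knitCinv mem η U₀ dY n μ)
      = liftL (mem n) (QpsY (mem n) (parKnitY (mem n)) (bgY (mem n) U₀) ((dY n hn hnm).C' (descBL (mem n) μ))) := by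
  have hκ : ((((((ℓ + 1 : ℕ) : ℝ)) ^ (d + 1))⁻¹) ^ n : ℝ) * (((((ℓ + 1 : ℕ) : ℝ)) ^ (d + 1)) ^ n : ℝ) = 1 := by
    rw [inv_pow, inv_mul_cancel₀ (pow_ne_zero _ (pow_ne_zero _ (by positivity)))]
  rw [knitCinv_apply mem η U₀ dY hn hnm, knitQpT_liftBL mem U₀ hP hlev hU₀per hn hnm, map_smul, map_smul, ← Complex.coe_smul, smul_smul,
    ← Complex.ofReal_mul, hκ, Complex.ofReal_one, one_smul]

include hP hlev hU₀per in
/-- ★ **THE CONSUMER's `R`-EXPRESSION IS THE LIFT OF def-Y's**: for a `P`-periodic `f` with box reading `Φ = descL f`,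
`f − G′Q′ᵀCQ′G′f = (Φ − G'Q′*C'Q′G'Φ)♯`. [cite: Balaban1985RegularSpaces, (1.98) p.92 («R = I − G′Q′ᵀCQ′G′»); Balaban1985BackgroundPropagators, (3.25) p.395] -/
theorem knitR_eq_liftL {n : ℕ} (hn : 1 ≤ n) (hnm : n ≤ m) {f : LSite (d + 1) → 𝔸} (hf : ∀ (z : LSite (d + 1)) (i : Fin (d + 1)), f (z + P • e i) = f z) :
    f - knitGp mem η U₀ dY n (knitQpT (ℓ := ℓ) U₀ n (knitCinv mem η U₀ dY n (knitQp (ℓ := ℓ) U₀ n (knitGp mem η U₀ dY n f))))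
      = liftL (mem n) (descL (mem n) f - (dY n hn hnm).G' (QpsY (mem n) (parKnitY (mem n)) (bgY (mem n) U₀)
          ((dY n hn hnm).C' (QpY (mem n) (parKnitY (mem n)) (bgY (mem n) U₀) ((dY n hn hnm).G' (descL (mem n) f)))))) := by
  have hfl : liftL (mem n) (descL (mem n) f) = f := liftL_descL (mem n) (per_mem mem hP hn hnm hf)
  conv_lhs => rw [← hfl]
  rw [knitGp_liftL mem η U₀ dY hn hnm, knitQpT_knitCinv mem η U₀ dY hP hlev hU₀per hn hnm, descBL_knitQp_liftL mem U₀ hP hlev hU₀per hn hnm,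
    knitGp_liftL mem η U₀ dY hn hnm, ← map_sub]

/-! ### the estimate laws, displayed (verbatim shapes of `LettersAtPer`, about the letters of §2) -/

/-- **THE SIX ESTIMATE LAWS OF `LettersAtPer` FOR THE LETTERS OF §2, AS HYPOTHESES** (nothing asserted): (E6)–(E8) = [B8] (1.92) for `H′` (sup, weighted
gradient, `(−2)`-Laplacian lines), (E12) = (1.101) for `G′` ([4] (3.42)₁,₂), (E15) = (1.98) for `R`, (B) = the in-edge b9 (1.59) in Proposition 3's frame ([4]
Thm 3.3) — every argument `P`-periodic.  Junction J-B files 11∕15∕16 (p33) prove the (E12) lines on def-Y's side; (E6)–(E8), (E15), (B) are sub-row G-B9-LETTERS'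
remaining modules; a norms dictionary turns those into an inhabitant of this bundle.
[cite: Balaban1985RegularSpaces, (1.92) p.91, (1.98) p.92, (1.101) p.93, (1.57)–(1.59) p.86; Balaban1985BackgroundPropagators, Thm 3.1 p.397, Thm 3.2 p.398, Thm 3.3 p.399] -/
structure KnitEstimates (L : ℕ) (BG BR B₀'H B₂' B₀ B₀β cB β : ℝ) (len : LSite (d + 1) → ℝ) (α₀ : ℝ) (P : ℤ) : Prop where
  /-- (E6) (1.92), sup line for `H′`. -/
  hp_sup : ∀ n, 1 ≤ n → n ≤ m → ∀ (X : XSpace (d := d + 1) n 𝔸),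
    (∀ (p : Fin (n + 1) × LSite (d + 1)) (i : Fin (d + 1)), X (p.1, p.2 + (P / (L : ℤ) ^ (p.1 : ℕ)) • e i) = X p) →
    ∀ (x : LSite (d + 1)), ‖knitHp mem η U₀ dY n X x‖ ≤ B₀'H * ‖X‖
  /-- (E7) (1.92), weighted-gradient line for `H′`. -/
  hp_grad : ∀ n, 1 ≤ n → n ≤ m → ∀ j, j ≤ n → ∀ (X : XSpace (d := d + 1) n 𝔸),
    (∀ (p : Fin (n + 1) × LSite (d + 1)) (i : Fin (d + 1)), X (p.1, p.2 + (P / (L : ℤ) ^ (p.1 : ℕ)) • e i) = X p) →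
    ∀ p ∈ {b : LSite (d + 1) × Fin (d + 1) | SideTouches (Set.univ : Set (LSite (d + 1))) b.1 b.2},
      wt L η j * ‖covDerivFwd η U₀ p.2 (knitHp mem η U₀ dY n X) p.1‖ ≤ B₀'H * ‖X‖
  /-- (E8) (1.92), `(−2)`-Laplacian line for `H′`. -/
  hp_lap : ∀ n, 1 ≤ n → n ≤ m → ∀ X : XSpace (d := d + 1) n 𝔸,
    (∀ (p : Fin (n + 1) × LSite (d + 1)) (i : Fin (d + 1)), X (p.1, p.2 + (P / (L : ℤ) ^ (p.1 : ℕ)) • e i) = X p) →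
    Bd2 L η n (fun _ => (Set.univ : Set (LSite (d + 1)))) (covLap η U₀ (knitHp mem η U₀ dY n X)) (B₂' * ‖X‖)
  /-- (E12) (1.101) for `G′`: sup and weighted gradient. -/
  gp_sup_grad : ∀ n, 1 ≤ n → n ≤ m → ∀ (f : LSite (d + 1) → 𝔸), (∀ (z : LSite (d + 1)) (i : Fin (d + 1)), f (z + P • e i) = f z) → ∀ (r : ℝ), 0 ≤ r →
    Bd2 L η n (fun _ => (Set.univ : Set (LSite (d + 1)))) f r →
    (∀ x, ‖knitGp mem η U₀ dY n f x‖ ≤ BG * r) ∧ ∀ j, j ≤ n → ∀ p ∈ {b : LSite (d + 1) × Fin (d + 1) | SideTouches (Set.univ : Set (LSite (d + 1))) b.1 b.2},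
      wt L η j * ‖covDerivFwd η U₀ p.2 (knitGp mem η U₀ dY n f) p.1‖ ≤ BG * r
  /-- (E15) (1.98) for `R = 1 − G′Q′ᵀCQ′G′`. -/
  r_bound : ∀ n, 1 ≤ n → n ≤ m → ∀ (f : LSite (d + 1) → 𝔸), (∀ (z : LSite (d + 1)) (i : Fin (d + 1)), f (z + P • e i) = f z) → ∀ (r : ℝ), 0 ≤ r →
    Bd2 L η n (fun _ => (Set.univ : Set (LSite (d + 1)))) f r →
    Bd2 L η n (fun _ => (Set.univ : Set (LSite (d + 1))))
      (f - knitGp mem η U₀ dY n (knitQpT (ℓ := ℓ) U₀ n (knitCinv mem η U₀ dY n (knitQp (ℓ := ℓ) U₀ n (knitGp mem η U₀ dY n f))))) (BR * r)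
  /-- (B) the in-edge b9 in Proposition 3's frame at truncation `m`, periodic `W`, `A′`. -/
  b9P3 : ∀ α₂ : ℝ, 0 < α₂ → α₂ ≤ cB →
    ∀ W : LSite (d + 1) → Fin (d + 1) → 𝔸ˣ, (∀ x κ, W x κ ∈ unitaryUnits 𝔸) → (∀ (z : LSite (d + 1)) (i : Fin (d + 1)), W (z + P • e i) = W z) →
    InAk L m η α₀ (fun _ => (Set.univ : Set (LSite (d + 1)))) U₀ →
    InAk L m η α₀ (fun _ => (Set.univ : Set (LSite (d + 1)))) (mulCfg W U₀) →
    IsLandau138W L m η (Set.univ : Set (LSite (d + 1))) (torusLam (d := d + 1) m) U₀ W →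
    ∀ A' : LSite (d + 1) → Fin (d + 1) → 𝔸, (∀ y τ, IsSelfAdjoint (A' y τ)) → (∀ (z : LSite (d + 1)) (i : Fin (d + 1)), A' (z + P • e i) = A' z) →
    (∀ j, j ≤ m → ∀ (y : LSite (d + 1)) (τ : Fin (d + 1)), SideTouches (Set.univ : Set (LSite (d + 1))) y τ →
      W y τ = cfgExp η A' y τ ∧ ‖A' y τ‖ ≤ α₂ * ((L : ℝ) ^ j * η)⁻¹) →
    (∀ (y : LSite (d + 1)) (τ : Fin (d + 1)), (∀ j, j ≤ m → ¬ SideTouches (Set.univ : Set (LSite (d + 1))) y τ) → A' y τ = 0) →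
    msup L m η (-(1 : ℝ)) (fun _ (b : LSite (d + 1) × Fin (d + 1)) => SideTouches (Set.univ : Set (LSite (d + 1))) b.1 b.2) (fun b => A' b.1 b.2)
        ≤ B₀ * (bondNorm L m η (-(3 : ℝ)) (fun _ => (Set.univ : Set (LSite (d + 1)))) (fun x μ => Jcur η U₀ A' μ x)
          + wsup 1 (fun p : {p : ℕ × (LSite (d + 1) × Fin (d + 1)) // p.1 ≤ m ∧ p.2 ∈ torusLamb (d := d + 1) m p.1} =>
              linCovIter L U₀ (iEta η A') p.1.1 p.1.2.1 p.1.2.2)) ∧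
      msup L m η (-(2 : ℝ)) (fun _ (t : Fin (d + 1) × Fin (d + 1) × LSite (d + 1)) => SideTouches (Set.univ : Set (LSite (d + 1))) t.2.2 t.2.1)
          (fun t => covDerivFwd η U₀ t.1 (fun z => A' z t.2.1) t.2.2)
        ≤ B₀ * (bondNorm L m η (-(3 : ℝ)) (fun _ => (Set.univ : Set (LSite (d + 1)))) (fun x μ => Jcur η U₀ A' μ x)
          + wsup 1 (fun p : {p : ℕ × (LSite (d + 1) × Fin (d + 1)) // p.1 ≤ m ∧ p.2 ∈ torusLamb (d := d + 1) m p.1} =>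
              linCovIter L U₀ (iEta η A') p.1.1 p.1.2.1 p.1.2.2)) ∧
      bondNorm L m η (-(3 : ℝ)) (fun _ => (Set.univ : Set (LSite (d + 1)))) (fun x μ => pdiv η U₀ (plaqCovDeriv η U₀ A') μ x)
        ≤ B₀ * (bondNorm L m η (-(3 : ℝ)) (fun _ => (Set.univ : Set (LSite (d + 1)))) (fun x μ => Jcur η U₀ A' μ x)
          + wsup 1 (fun p : {p : ℕ × (LSite (d + 1) × Fin (d + 1)) // p.1 ≤ m ∧ p.2 ∈ torusLamb (d := d + 1) m p.1} =>
              linCovIter L U₀ (iEta η A') p.1.1 p.1.2.1 p.1.2.2)) ∧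
      bondNorm L m η (-(3 : ℝ)) (fun _ => (Set.univ : Set (LSite (d + 1)))) (fun x μ => covLap η U₀ (fun z => A' z μ) x)
        ≤ B₀ * (bondNorm L m η (-(3 : ℝ)) (fun _ => (Set.univ : Set (LSite (d + 1)))) (fun x μ => Jcur η U₀ A' μ x)
          + wsup 1 (fun p : {p : ℕ × (LSite (d + 1) × Fin (d + 1)) // p.1 ≤ m ∧ p.2 ∈ torusLamb (d := d + 1) m p.1} =>
              linCovIter L U₀ (iEta η A') p.1.1 p.1.2.1 p.1.2.2)) ∧
      msup L m η (-(2 + β)) (fun _ (q : Fin (d + 1) × Fin (d + 1) × (LSite (d + 1) × LSite (d + 1))) =>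
            q.2.2 ∈ AdmPair η len ∧ q.2.2.1 ∈ (Set.univ : Set (LSite (d + 1))))
          (fun q => hquot η β len U₀ (covDerivFwd η U₀ q.1 (fun z => A' z q.2.1)) q.2.2)
        ≤ B₀β * (bondNorm L m η (-(3 : ℝ)) (fun _ => (Set.univ : Set (LSite (d + 1)))) (fun x μ => Jcur η U₀ A' μ x)
          + wsup 1 (fun p : {p : ℕ × (LSite (d + 1) × Fin (d + 1)) // p.1 ≤ m ∧ p.2 ∈ torusLamb (d := d + 1) m p.1} =>
              linCovIter L U₀ (iEta η A') p.1.1 p.1.2.1 p.1.2.2))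

/-! ### ★★★ the bundle -/

/-- ★★★ **`LettersAtPer` AT A TORUS MEMBER, CONSTRUCTED FROM THE def-Y-SIDE LETTERS.**  For a family `mem` of constant-level members of the k-level family (member
`n` of level `n`, all on the torus of side `P`, `1 ≤ n ≤ m`), a `P`-periodic background `U₀` on `ℤ^{d+1}`, `η`, and def-Y-side letters `dY n : KnitLettersY
(mem n) n η U₀` with their exact algebra: the seven letters of §2 satisfy EVERY law of `B8Thm2TorusLettersPer.LettersAtPer (ℓ+1) … η m α₀ P U₀` — (P1)–(P6),
(E1)–(E5), (E9)–(E11), (E13), (E14), (E16), (U1)–(U3) PROVED here; (E6)–(E8), (E12), (E15), (B) taken from the displayed `KnitEstimates`.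
[cite: Balaban1985RegularSpaces, Thm 2 p.83, p.77 («Ω_j = T_η»), (1.29) p.81, (1.91)–(1.92) p.91, (1.95)–(1.98) p.92, (1.101) p.93, Prop. 5 p.94, (1.59) p.86; Balaban1985BackgroundPropagators, (3.19)–(3.25) pp.393–395, Thms 3.1–3.3 pp.397–399, Thm 3.11 p.416] -/
def lettersAtPer_ofKnit {BG BR B₀'H B₂' B₀ B₀β cB β : ℝ} {len : LSite (d + 1) → ℝ} {α₀ : ℝ}
    (hP : ∀ n, 1 ≤ n → n ≤ m → (((PV d ℓ (mem n).m (mem n).K hd hL).sitesPerDir 0 : ℕ) : ℤ) = P)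
    (hlev : ∀ n, 1 ≤ n → n ≤ m → ∀ z : SiteY (mem n), levY (mem n) z = n)
    (hU₀per : ∀ (x : LSite (d + 1)) (μ : Fin (d + 1)), U₀ (x + P • e μ) = U₀ x)
    (est : KnitEstimates (𝔸 := 𝔸) mem η U₀ dY (ℓ + 1) BG BR B₀'H B₂' B₀ B₀β cB β len α₀ P) :
    LettersAtPer (𝔸 := 𝔸) (ℓ + 1) BG BR B₀'H B₂' B₀ B₀β cB β len η m α₀ P U₀ where
  Gp := knitGp mem η U₀ dY
  lapU := fun _ => knitLapU η U₀
  Qp := knitQp (ℓ := ℓ) U₀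
  QpT := knitQpT (ℓ := ℓ) U₀
  Aw := fun _ => knitAw (d := d) (ℓ := ℓ) η
  Cinv := knitCinv mem η U₀ dY
  Hp := knitHp mem η U₀ dY
  gp_per := fun n hn hnm f _ z i => by
    rw [knitGp_apply mem η U₀ dY hn hnm, ← hP n hn hnm, liftL_add_period]
  qp_per := fun n hn hnm f hf j hj y i => by
    by_cases hjn : j = n
    · have hk : n ≤ (mem n).k := constLev_le (mem n) (hlev n hn hnm)
      have hf' : ∀ μ, shiftCfg ((((PV d ℓ (mem n).m (mem n).K hd hL).sitesPerDir 0 : ℕ) : ℤ) • e μ) f = f :=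
        fun μ => funext fun x => by rw [shiftCfg_apply]; exact per_mem mem hP hn hnm hf x μ
      have h := QprimeIter_periodic (mem n) (bgY (mem n) U₀) hf' hk y i
      rw [liftCfg_bgY_mem mem U₀ hP hU₀per hn hnm, ← period_div_pow (mem n) hk i, hP n hn hnm] at h
      rw [knitQp_of_eq U₀ n f hjn, hjn]
      exact h
    · rw [knitQp_of_ne U₀ n f hjn, Pi.zero_apply, Pi.zero_apply]
  qpT_per := fun n hn hnm μ hμ z i => by
    have hk : n ≤ (mem n).k := constLev_le (mem n) (hlev n hn hnm)
    have hν : shiftCfg (((qLev (mem n) n i : ℕ) : ℤ) • e i) (μ n) = μ n := by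
      funext y; rw [shiftCfg_apply, ← period_div_pow (mem n) hk i, hP n hn hnm]; exact hμ n le_rfl y i
    have h := QT_periodic (mem n) (bgY (mem n) U₀) hk i hν z
    rw [liftCfg_bgY_mem mem U₀ hP hU₀per hn hnm, hP n hn hnm] at h
    rw [knitQpT_apply, knitQpT_apply, h]
  aw_per := fun n _ _ μ hμ j hj y i => by
    show knitAw (d := d) (ℓ := ℓ) η μ j (y + _) = knitAw (d := d) (ℓ := ℓ) η μ j y
    rw [knitAw, awOp_apply, awOp_apply, hμ j hj y i]
  cinv_per := fun n hn hnm μ _ j _ y i => by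
    rw [knitCinv_apply mem η U₀ dY hn hnm, ← hP n hn hnm, liftBL_add_period (mem n) (hlev n hn hnm)]
  hp_per := fun n hn hnm X _ z i => by
    rw [knitHp_eq mem η U₀ dY hn hnm, ← hP n hn hnm, liftL_add_period]
  gp_right := fun n hn hnm x hx y _ => by
    have hxl : liftL (mem n) (descL (mem n) x) = x := liftL_descL (mem n) (per_mem mem hP hn hnm hx)
    show covLapₗ η U₀ (knitGp mem η U₀ dY n x) y
        + QT (ℓ + 1) n (torusLam (d := d + 1) n) U₀ (knitAw (d := d) (ℓ := ℓ) η (knitQp (ℓ := ℓ) U₀ n (knitGp mem η U₀ dY n x))) y = x y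
    rw [covLapₗ_apply, QT_knitAw_knitQp, knitGp_apply mem η U₀ dY hn hnm, (dY n hn hnm).e1 (descL (mem n) x) y, hxl]
  cinv_range := fun n hn hnm f hf => by
    have hfl : liftL (mem n) (descL (mem n) f) = f := liftL_descL (mem n) (per_mem mem hP hn hnm hf)
    funext j y
    by_cases hjn : j = n
    · rw [knitQp_of_eq U₀ n _ hjn, knitQp_of_eq U₀ n f hjn]
      conv_lhs => rw [← hfl]
      conv_rhs => rw [← hfl]
      rw [knitQpT_knitCinv mem η U₀ dY hP hlev hU₀per hn hnm, descBL_knitQp_liftL mem U₀ hP hlev hU₀per hn hnm,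
        knitGp_liftL mem η U₀ dY hn hnm, knitGp_liftL mem η U₀ dY hn hnm, QprimeIter_liftL_mem mem U₀ hP hlev hU₀per hn hnm,
        QprimeIter_liftL_mem mem U₀ hP hlev hU₀per hn hnm, (dY n hn hnm).e2]
    · rw [knitQp_of_ne U₀ n _ hjn, knitQp_of_ne U₀ n _ hjn]
  lapU_reads := fun n _ _ f _ x _ => by
    show covLapₗ η U₀ f x = _
    rw [covLapₗ_apply, Set.indicator_univ]
  qpT_reads := fun n _ _ μ _ x _ => rfl
  qp_reads := fun n _ _ f _ j _ y hy => by
    rw [knitQp_apply, if_pos ((mem_torusLam_iff n j y).1 hy)]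
  hp_sup := est.hp_sup
  hp_grad := est.hp_grad
  hp_lap := est.hp_lap
  hp_dirichlet := fun n _ _ X _ x hx => absurd (Set.mem_univ x) hx
  hp_real := fun n hn hnm X Y _ _ hXY x => by
    rw [knitHp_apply mem η U₀ dY hn hnm, knitHp_apply mem η U₀ dY hn hnm]
    exact (dY n hn hnm).e10 (descXL (mem n) n X) (descXL (mem n) n Y) (fun p => by rw [descXL_apply, descXL_apply, hXY]) _
  qp_hp := fun n hn hnm Y hY j hj y hy => by
    have hjn : j = n := (mem_torusLam_iff n j y).1 hy
    have hfin : (⟨j, Nat.lt_succ_of_le hj⟩ : Fin (n + 1)) = Fin.last n := Fin.ext hjn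
    rw [hfin, hjn, knitHp_eq mem η U₀ dY hn hnm, QprimeIter_liftL_mem mem U₀ hP hlev hU₀per hn hnm, (dY n hn hnm).e11,
      descXL_blkAt (mem n) (hlev n hn hnm) (levPerX_mem mem hP hn hnm hY)]
  gp_sup_grad := est.gp_sup_grad
  gp_dirichlet := fun n _ _ f _ x hx => absurd (Set.mem_univ x) hx
  gp_real := fun n hn hnm f _ hsa x => by
    rw [knitGp_apply mem η U₀ dY hn hnm, liftL_apply]
    exact (dY n hn hnm).e14 (descL (mem n) f) (fun w => hsa n le_rfl w.1 (Set.mem_univ _)) _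
  r_bound := est.r_bound
  r_real := fun n hn hnm f hf hsa j _ x _ => by
    rw [knitR_eq_liftL mem η U₀ dY hP hlev hU₀per hn hnm hf, liftL_apply]
    exact (dY n hn hnm).e16 (descL (mem n) f) (fun w => hsa n le_rfl w.1 (Set.mem_univ _)) _
  gp_left_bdd := fun hm x hx _ => by
    have hxl : liftL (mem m) (descL (mem m) x) = x := liftL_descL (mem m) (per_mem mem hP hm le_rfl hx)
    rw [knitGp_apply mem η U₀ dY hm le_rfl]
    conv_rhs => rw [← hxl, ← (dY m hm le_rfl).u1 (descL (mem m) x)]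
    refine congrArg (fun Φ => liftL (mem m) Φ) (congrArg (fun Φ => (dY m hm le_rfl).G' Φ) ?_)
    funext z
    rw [descL_apply, Pi.add_apply, hxl]
    show covLapₗ η U₀ x z.1 + QT (ℓ + 1) m (torusLam (d := d + 1) m) U₀ (knitAw (d := d) (ℓ := ℓ) η (knitQp (ℓ := ℓ) U₀ m x)) z.1 = _
    rw [covLapₗ_apply, QT_knitAw_knitQp]
  cinv_range' := fun hm φ hφ => by
    have hφl : knitQpT (ℓ := ℓ) U₀ m φ = ((((((((ℓ + 1 : ℕ) : ℝ)) ^ (d + 1))⁻¹) ^ m : ℝ)) : ℂ) •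
        liftL (mem m) (QpsY (mem m) (parKnitY (mem m)) (bgY (mem m) U₀) (descBL (mem m) φ)) := by
      funext x
      have h := QT_eq_liftL_QpsY (mem m) (hlev m hm le_rfl) (bgY (mem m) U₀) (levPer_mem mem hP hm le_rfl hφ) x
      rw [liftCfg_bgY_mem mem U₀ hP hU₀per hm le_rfl] at h
      rw [knitQpT_apply, h, Pi.smul_apply, Complex.coe_smul]
    rw [hφl, map_smul, map_smul, map_smul, map_smul, map_smul, knitGp_liftL mem η U₀ dY hm le_rfl, knitGp_liftL mem η U₀ dY hm le_rfl,
      knitQpT_knitCinv mem η U₀ dY hP hlev hU₀per hm le_rfl, descBL_knitQp_liftL mem U₀ hP hlev hU₀per hm le_rfl, (dY m hm le_rfl).u2]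
  qp_zero_off := fun hm f _ j y hjy => by
    by_cases hjm : j = m
    · exact absurd ⟨hjm.le, (mem_torusLam_iff m j y).2 hjm⟩ hjy
    · rw [knitQp_of_ne U₀ m f hjm, Pi.zero_apply]
  b9P3 := est.b9P3

/-- ★ **THE `τ`-LAWS OF THE BUNDLE from the def-Y-side `τ`-laws** (`B8Thm2TorusLettersPer.LettersPerTau`): `H′`, `G′`, `R` of §2 map `τ`-free periodic data to
`τ`-free values when the def-Y-side letters do (displayed: `KnitLettersYTau`). [cite: Balaban1985RegularSpaces, p.76, (1.91)–(1.98) pp.91–92] -/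
theorem lettersPerTau_ofKnit (τ : 𝔸 →L[ℂ] ℂ) {BG BR B₀'H B₂' B₀ B₀β cB β : ℝ} {len : LSite (d + 1) → ℝ} {α₀ : ℝ}
    (hP : ∀ n, 1 ≤ n → n ≤ m → (((PV d ℓ (mem n).m (mem n).K hd hL).sitesPerDir 0 : ℕ) : ℤ) = P)
    (hlev : ∀ n, 1 ≤ n → n ≤ m → ∀ z : SiteY (mem n), levY (mem n) z = n)
    (hU₀per : ∀ (x : LSite (d + 1)) (μ : Fin (d + 1)), U₀ (x + P • e μ) = U₀ x)
    (est : KnitEstimates (𝔸 := 𝔸) mem η U₀ dY (ℓ + 1) BG BR B₀'H B₂' B₀ B₀β cB β len α₀ P)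
    (hτ : ∀ n (hn : 1 ≤ n) (hnm : n ≤ m), KnitLettersYTau τ (dY n hn hnm)) :
    LettersPerTau (𝔸 := 𝔸) τ (lettersAtPer_ofKnit mem η U₀ dY hP hlev hU₀per est) where
  hp_tau := fun n hn hnm X _ hX x => by
    show τ (knitHp mem η U₀ dY n X x) = 0
    rw [knitHp_apply mem η U₀ dY hn hnm]
    exact (hτ n hn hnm).h_tau (descXL (mem n) n X) (fun p => hX _) _
  gp_tau := fun n hn hnm f _ hf x => by
    show τ (knitGp mem η U₀ dY n f x) = 0
    rw [knitGp_apply mem η U₀ dY hn hnm, liftL_apply]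
    exact (hτ n hn hnm).g_tau (descL (mem n) f) (fun w => hf n le_rfl w.1 (Set.mem_univ _)) _
  r_tau := fun n hn hnm f hfp hf j _ x _ => by
    show τ ((f - knitGp mem η U₀ dY n (knitQpT (ℓ := ℓ) U₀ n (knitCinv mem η U₀ dY n (knitQp (ℓ := ℓ) U₀ n (knitGp mem η U₀ dY n f))))) x) = 0
    rw [knitR_eq_liftL mem η U₀ dY hP hlev hU₀per hn hnm hfp, liftL_apply]
    exact (hτ n hn hnm).r_tau (descL (mem n) f) (fun w => hf n le_rfl w.1 (Set.mem_univ _)) _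

end Laws

/-! ## §4 At `𝔸 = M_N(ℂ)`: the def-Y-side bundle inhabited by the junction's objects; the consumer's bundle from [4]'s objects -/

section MatrixCase

open scoped Matrix Matrix.Norms.L2Operator

variable {N : ℕ} (i : KIdx d ℓ hd hL b₀ b₁) {G : Subgroup (Matrix (Fin N) (Fin N) ℂ)ˣ}

/-- ★★★ **THE def-Y-SIDE BUNDLE `KnitLettersY` INHABITED BY THE JUNCTION's [4] OBJECTS AT PRINT's TRANSPORTERS.**  At a constant-level member `i` (level `n`), for
`G ≤ U(N)`, a `G`-valued `N₀`-periodic background `U₀` with `G`-valued knit legs and `η ≠ 0`: `G' := GpKnitY i η U = η²·Δ′_a(U; parKnitY)⁻¹`, `C' := (Q′(η²G′)²Q′*)⁻¹`,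
`H' := G′G′Q′*(Q′G′²Q′*)⁻¹` (`U = descCfg U₀`), with `e1` = `B9B8KnitLetterPeriodic.knit_E1`, `u1` = `B9B8KnitLetterRealityLeftInv.knit_U1_at_box`, `e2`∕`u2`∕`e11`∕`e10` =
`B9B8KnitLetterProjectionC.knit_E2_smul ∕ knit_U2_smul ∕ knit_E11 ∕ knit_E10`, `e14` = `isSelfAdjoint_GpKnitY_apply`, `e16` = `isSelfAdjoint_RY_parKnitY_apply` — by NAME.
[cite: Balaban1985BackgroundPropagators, (3.24)–(3.25) pp.394–395, Thm 3.11 p.416, p.391; Balaban1985RegularSpaces, (1.91) p.91, (1.95)–(1.98) p.92, Prop. 5 p.94] -/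
def knitLettersY_ofParKnitY {n : ℕ} (hlev : ∀ z : SiteY i, levY i z = n) (hG : G ≤ unitaryUnits (Matrix (Fin N) (Fin N) ℂ))
    {U₀ : LSite (d + 1) → Fin (d + 1) → (Matrix (Fin N) (Fin N) ℂ)ˣ} (hU₀G : ∀ x μ, U₀ x μ ∈ G)
    (hU₀per : ∀ μ : Fin (d + 1), shiftCfg ((((PV d ℓ i.m i.K hd hL).sitesPerDir 0 : ℕ) : ℤ) • e μ) U₀ = U₀)
    (hpar : ∀ z w : SiteY i, parKnitY i (bgY i U₀) z w ∈ G) {η : ℝ} (hη : η ≠ 0) :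
    KnitLettersY i n η U₀ where
  G' := GpKnitY i η (bgY i U₀)
  C' := XinvY i (parKnitY i) ((((η * η : ℝ)) : ℂ) • GpY i (parKnitY i)) (bgY i U₀)
  H' := GpY i (parKnitY i) (bgY i U₀) ∘ₗ GpY i (parKnitY i) (bgY i U₀) ∘ₗ QpsY i (parKnitY i) (bgY i U₀)
    ∘ₗ XinvY i (parKnitY i) (GpY i (parKnitY i)) (bgY i U₀)
  e1 := fun X x => by
    have h := knit_E1 i hlev hG (bgY_mem i hU₀G) hpar hη X x
    rw [liftCfg_bgY i hU₀per, ← liftL_eq, ← liftL_eq] at h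
    exact h
  u1 := fun Λ => by
    have h := knit_U1_at_box i hlev hG (bgY_mem i hU₀G) hpar hη Λ
    rw [liftCfg_bgY i hU₀per, ← liftL_eq] at h
    exact h
  e2 := fun Φ => knit_E2_smul i hG (bgY_mem i hU₀G) hpar (Complex.ofReal_ne_zero.mpr (mul_ne_zero hη hη)) Φ
  u2 := fun φ => knit_U2_smul i hG (bgY_mem i hU₀G) hpar (Complex.ofReal_ne_zero.mpr (mul_ne_zero hη hη)) φ
  e11 := fun Y => knit_E11 i hG (bgY_mem i hU₀G) hpar Y
  e10 := fun Xf Yf hY z => knit_E10 i hG (bgY_mem i hU₀G) hpar hY z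
  e14 := fun Λ hΛ z => isSelfAdjoint_GpKnitY_apply i hG (bgY_mem i hU₀G) hpar η hΛ z
  e16 := fun Φ hΦ z => by
    have h := isSelfAdjoint_RY_parKnitY_apply i hG (bgY_mem i hU₀G) hpar hΦ z
    rw [← RY_parKnitY_smul i (bgY i U₀) (Complex.ofReal_ne_zero.mpr (mul_ne_zero hη hη))] at h
    exact h

/-- **THE FAMILY OF def-Y-SIDE BUNDLES over the truncations `1 ≤ n ≤ m`** at a `P`-periodic `G`-valued background whose knit legs are `G`-valued at every
member of the family. [cite: Balaban1985BackgroundPropagators, (3.24)–(3.25) pp.394–395; Balaban1985RegularSpaces, (1.91)–(1.98) pp.91–92] -/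
def knitLettersY_family (mem : ℕ → KIdx d ℓ hd hL b₀ b₁) {m : ℕ} {P : ℤ}
    (hP : ∀ n, 1 ≤ n → n ≤ m → (((PV d ℓ (mem n).m (mem n).K hd hL).sitesPerDir 0 : ℕ) : ℤ) = P)
    (hlev : ∀ n, 1 ≤ n → n ≤ m → ∀ z : SiteY (mem n), levY (mem n) z = n)
    (hG : G ≤ unitaryUnits (Matrix (Fin N) (Fin N) ℂ))
    {U₀ : LSite (d + 1) → Fin (d + 1) → (Matrix (Fin N) (Fin N) ℂ)ˣ} (hU₀G : ∀ x μ, U₀ x μ ∈ G)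
    (hU₀per : ∀ (x : LSite (d + 1)) (μ : Fin (d + 1)), U₀ (x + P • e μ) = U₀ x)
    (hpar : ∀ n, 1 ≤ n → n ≤ m → ∀ z w : SiteY (mem n), parKnitY (mem n) (bgY (mem n) U₀) z w ∈ G)
    {η : ℝ} (hη : η ≠ 0) : ∀ n, 1 ≤ n → n ≤ m → KnitLettersY (mem n) n η U₀ :=
  fun n hn hnm => knitLettersY_ofParKnitY (mem n) (hlev n hn hnm) hG hU₀G
    (fun μ => funext fun x => by rw [shiftCfg_apply, hP n hn hnm, hU₀per]) (hpar n hn hnm) hη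

/-- ★★★ **THE CONSUMER's v3 LETTER BUNDLE AT A TORUS MEMBER FROM [4]'s OBJECTS** (the displayed hypothesis `LettersAllPer … U₀` of the G-B8-T2S endpoint
`B8Thm2TorusAtOfLettersPerB9.thm2TorusAt_specialUnitary_of_lettersPerB9`, at ONE background, made CONCRETE): for a family `mem` of constant-level members (one
per truncation `n ≤ m`, all on the torus of side `P`), `G ≤ U(N)`, a `G`-valued `P`-periodic `U₀` whose knit legs are `G`-valued at every member, `η ≠ 0`:
the bundle `LettersAtPer (ℓ+1) … η m α₀ P U₀` whose letters ARE `η²G′(U₀)`, `Δ_{U₀}`, `Q′(U₀)`, `Q′(U₀)ᵀ`, `𝔄`, `(L^{d+1})ⁿ(Q′(η²G′)²Q′*)⁻¹`, `G′²Q′*(Q′G′²Q′*)⁻¹`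
of [4] §3 at print's transporters — MODULO the six printed inequalities for these very objects (`KnitEstimates`: (1.92), (1.101), (1.98), (1.59)).
HONEST SCOPE: no estimate proved; member constraints of def-Y's carrier displayed; count-neutral; the Yang–Mills mass gap is NOT proved.
[cite: Balaban1985RegularSpaces, Thm 2 p.83, p.77 («Ω_j = T_η»), (1.91)–(1.92) p.91, (1.95)–(1.98) p.92, (1.101) p.93, (1.59) p.86; Balaban1985BackgroundPropagators, (3.19)–(3.25) pp.393–395, Thms 3.1–3.3 pp.397–399, Thm 3.11 p.416] -/
def lettersAtPer_ofParKnitY (mem : ℕ → KIdx d ℓ hd hL b₀ b₁) {m : ℕ} {P : ℤ}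
    (hP : ∀ n, 1 ≤ n → n ≤ m → (((PV d ℓ (mem n).m (mem n).K hd hL).sitesPerDir 0 : ℕ) : ℤ) = P)
    (hlev : ∀ n, 1 ≤ n → n ≤ m → ∀ z : SiteY (mem n), levY (mem n) z = n)
    (hG : G ≤ unitaryUnits (Matrix (Fin N) (Fin N) ℂ))
    {U₀ : LSite (d + 1) → Fin (d + 1) → (Matrix (Fin N) (Fin N) ℂ)ˣ} (hU₀G : ∀ x μ, U₀ x μ ∈ G)
    (hU₀per : ∀ (x : LSite (d + 1)) (μ : Fin (d + 1)), U₀ (x + P • e μ) = U₀ x)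
    (hpar : ∀ n, 1 ≤ n → n ≤ m → ∀ z w : SiteY (mem n), parKnitY (mem n) (bgY (mem n) U₀) z w ∈ G)
    {η : ℝ} (hη : η ≠ 0) {BG BR B₀'H B₂' B₀ B₀β cB β : ℝ} {len : LSite (d + 1) → ℝ} {α₀ : ℝ}
    (est : letI : CStarAlgebra (Matrix (Fin N) (Fin N) ℂ) := {}
      KnitEstimates (𝔸 := Matrix (Fin N) (Fin N) ℂ) mem η U₀ (knitLettersY_family mem hP hlev hG hU₀G hU₀per hpar hη)
        (ℓ + 1) BG BR B₀'H B₂' B₀ B₀β cB β len α₀ P) :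
    letI : CStarAlgebra (Matrix (Fin N) (Fin N) ℂ) := {}
    LettersAtPer (𝔸 := Matrix (Fin N) (Fin N) ℂ) (ℓ + 1) BG BR B₀'H B₂' B₀ B₀β cB β len η m α₀ P U₀ :=
  letI : CStarAlgebra (Matrix (Fin N) (Fin N) ℂ) := {}
  lettersAtPer_ofKnit mem η U₀ (knitLettersY_family mem hP hlev hG hU₀G hU₀per hpar hη) hP hlev hU₀per est

end MatrixCase

end Literature.MathematicalPhysics.QuantumFieldTheory.Balaban1983to89.B8Thm2TorusLettersPerOfKnit

end
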